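import Summits.FinalStateConjecture.FinalStateConjecture.Theses.KerrnessPropagates
import Literature.Geometry.Lorentzian.ApproximateKerrConfigurationReanchor
import Summits.FinalStateConjecture.FinalStateConjecture.Theorems.NecksCertify.Negative.NecksCertifyFalseOfEqualVelocityBinaryWitness

/-!
# The lateness quantifier of the recurrence clause of `KillingSpinorEndgame` is idle
# (crux stmt-FinalStateConjecture-17645, route `KerrnessPropagates`; a finding about the TYPING of clause (i))

Clause (i) of `Theses.KerrnessPropagates.KillingSpinorEndgame` (verbatim also the recurrence conjunct of
`KerrBasinCapture`, stmt-17646) reads, once the configuration `p = (N; Mᵢ, aᵢ, r₀ᵢ; Λᵢ, cᵢ)` is fixed,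
`∀ ε > 0, ∀ τ₁, ∃ τ, τ₁ ≤ τ ∧ ∃ R U Φ, SlabClauses 𝒟 k N M a r₀ mo ε τ R U Φ` ("beyond every lab time one
`ε`-good achronal slab chart"), `SlabClauses` being the nine conjuncts below (`killingSpinorEndgame_iff`
is `Iff.rfl`). **The lab time `τ` is a free label**: `Φ` and `U` are chosen after `τ` and the references
are stationary, so for every COMOVING vector `u` (`Λⱼ⁻¹ u ∈ ℝ ∂₀` for all `j`) the translated chart
`Φ ∘ (· + u)` on `{x | x + u ∈ U}` satisfies the same clauses at lab time `τ − u⁰`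
(`slabClauses_translate`: `Kerr.radius_add_time_smul_basisVector`, `Kerr.bilin_add_smul_basisVector_zero`,
constancy of `η`, and the translation calculus of `ApproximateKerrConfigurationReanchor.lean`). A comoving
`u` with `u⁰ ≠ 0` exists whenever all `Λⱼ ∂₀` coincide (`(Λ ∂₀)⁰ ≠ 0`), in particular for `N = 0` and for
EVERY one-hole configuration. Hence (`recurrence_one_iff`, `recurrence_zero_iff`,
`recurrence_iff_exists_slab_of_forall_eq`): for `N ≤ 1` and for comoving configurations clause (i) at
accuracy `ε` is EQUIVALENT to the existence of ONE `ε`-good slab at SOME lab time — the quantifier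
`∀ τ₁, ∃ τ ≥ τ₁` adds nothing, and the crux's ENDGAME receives no lateness from CAPTURE (contrary to the
route's thesis "for every accuracy and arbitrarily late lab times"). Lateness has to be expressed
intrinsically (e.g. slabs disjoint from `J⁻(K)` for every compact `K`, as in
`Theses.BartnikGapSettling.Capture`).

References: Theses/KerrnessPropagates.lean; DHRT arXiv:2104.08222, §1; O'Neill 1983, Ch. 9, p. 236.
-/

open Literature.Geometry.Lorentzian
open scoped Manifold ContDiff Topology ENNReal
open Filter Set TopologicalSpace Function

-- `FinalStateConjecture.FinalStateConjecture` repeats summit = sub-problem (D-0017); deliberate.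
set_option linter.dupNamespace false

noncomputable section

namespace Summit.FinalStateConjecture.FinalStateConjecture.Theorems.KerrnessPropagates

open Summit.FinalStateConjecture.FinalStateConjecture.Theses.KerrnessPropagates

/-- Rest-frame coordinates after a lab translation by a COMOVING vector `u` (`Λ⁻¹ u = t ∂₀`):
`Λ⁻¹(x + u − c) = Λ⁻¹(x − c) + t ∂₀`. O'Neill 1983, Ch. 9, p. 236. [cite: ONeill1983, Ch. 9 p. 236] -/
theorem poincareInv_add_of_symm_eq (Λ : lorentzGroup) (c : E4) {u : E4} {t : ℝ}
    (hu : (Λ : E4 ≃L[ℝ] E4).symm u = t • E4.basisVector 0) (x : E4) :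
    poincareInv Λ c (x + u) = poincareInv Λ c x + t • E4.basisVector 0 := by
  unfold poincareInv
  rw [add_sub_right_comm, map_add, hu]

/-- The rest-frame Kerr–Schild radius does not see a comoving lab translation
(`Kerr.radius_add_time_smul_basisVector`). Visser arXiv:0706.0622, (35). [cite: arXiv07060622, (35)] -/
theorem radius_poincareInv_add_of_symm_eq (Λ : lorentzGroup) (c : E4) (a' : ℝ) {u : E4} {t : ℝ}
    (hu : (Λ : E4 ≃L[ℝ] E4).symm u = t • E4.basisVector 0) (x : E4) :
    Kerr.radius a' (poincareInv Λ c (x + u)) = Kerr.radius a' (poincareInv Λ c x) := by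
  rw [poincareInv_add_of_symm_eq Λ c hu, Kerr.radius_add_time_smul_basisVector]

/-- The boosted Kerr–Schild form does not see a comoving lab translation (stationarity of the
Kerr–Schild components, `Kerr.bilin_add_smul_basisVector_zero`). Kerr–Schild 1965, §2.
[cite: KerrSchild1965, §2] -/
theorem boostedKerrBilin_add_of_symm_eq (Λ : lorentzGroup) (c : E4) (M' a' : ℝ) {u : E4} {t : ℝ}
    (hu : (Λ : E4 ≃L[ℝ] E4).symm u = t • E4.basisVector 0) (x : E4) :
    boostedKerrBilin Λ c M' a' (x + u) = boostedKerrBilin Λ c M' a' x := by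
  ext v w
  rw [boostedKerrBilin_apply, boostedKerrBilin_apply, poincareInv_add_of_symm_eq Λ c hu,
    Kerr.bilin_add_smul_basisVector_zero]

/-- `Cᵏ` sup norms are transported by translations: the norm of `y ↦ f (y + u)` over `S` is the
norm of `f` over `S + u` (`iteratedFDeriv_comp_add_right`). Bartnik 1986, (1.3) (the norm);
folklore. [folklore] -/
theorem supCkENorm_comp_add_right {G : Type*} [NormedAddCommGroup G] [NormedSpace ℝ G]
    (S : Set E4) (k : ℕ) (f : E4 → G) (u : E4) :
    supCkENorm S k (fun y ↦ f (y + u)) = supCkENorm ((fun y ↦ y + u) '' S) k f := by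
  unfold supCkENorm
  refine le_antisymm (iSup₂_le fun m hm ↦ iSup₂_le fun y hy ↦ ?_)
    (iSup₂_le fun m hm ↦ iSup₂_le fun y hy ↦ ?_)
  · rw [iteratedFDeriv_comp_add_right]
    exact le_iSup₂_of_le m hm (le_iSup₂_of_le (y + u) ⟨y, hy, rfl⟩ le_rfl)
  · obtain ⟨x, hx, rfl⟩ := hy
    refine le_iSup₂_of_le m hm (le_iSup₂_of_le x hx ?_)
    rw [iteratedFDeriv_comp_add_right]

variable {X : Type} [TopologicalSpace X] [ChartedSpace E3 X] [IsManifold (𝓡 3) ∞ X]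
  [ConnectedSpace X] {D : InitialDataSet (𝓡 3) X}

/-- **The nine slab clauses of clause (i) of `KillingSpinorEndgame`** for the development `𝒟`,
regularity `k`, configuration `(N; M, a, r₀; mo)`, accuracy `ε`, lab time `τ`, near-zone radii `R`,
domain `U` and chart `Φ` — VERBATIM the block after `∃ (R …) (U …) (Φ …),` in the route file
(`killingSpinorEndgame_iff` is `Iff.rfl`): the near-zone tie `r₀ᵢ + 1 ≤ Rᵢ`; `Φ` smooth; `Φ` an open
embedding; `U` contains the punctured hyperplane `{x⁰ = τ, ∀ j, r₀ⱼ < rⱼ}`; `range Φ ⊆ J⁺(ι X)`;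
the leaf `Φ({x⁰ = τ})` achronal; `Cᵏ`-sup closeness `≤ ε` to boosted Kerr–Schild Kerrᵢ on each near disc
`{x⁰ = τ, ∀ j r₀ⱼ < rⱼ, rᵢ ≤ Rᵢ}` and to `η` on the far zone `{x⁰ = τ, ∀ j r₀ⱼ < rⱼ, ∀ j Rⱼ − 1 ≤ rⱼ}`;
`Φ_* ∂₀` future-directed on the far zone. DHRT arXiv:2104.08222, §1 (chart/slab/`Cᵏ` vocabulary);
Dafermos–Luk arXiv:1710.01722, Conjecture 1 (the final-state picture). [cite: arXiv210408222, §1] -/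
def SlabClauses (𝒟 : VacuumCauchyDevelopment D) (k N : ℕ) (M a r₀ : Fin N → ℝ)
    (mo : Fin N → ↥lorentzGroup × E4) (ε τ : ℝ) (R : Fin N → ℝ) (U : Opens E4)
    (Φ : U → 𝒟.carrier) : Prop :=
  (∀ i, r₀ i + 1 ≤ R i) ∧
    ContMDiff 𝓘(ℝ, E4) (𝓡 4) ∞ Φ ∧ Topology.IsOpenEmbedding Φ ∧
    {x : E4 | x 0 = τ ∧ ∀ j, r₀ j < Kerr.radius (a j) (poincareInv (mo j).1 (mo j).2 x)} ⊆
      (U : Set E4) ∧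
    range Φ ⊆ 𝒟.metric.causalFuture 𝒟.timeOrientation (range 𝒟.embed) ∧
    𝒟.metric.IsAchronal 𝒟.timeOrientation (Φ '' {x : ↥U | (x : E4) 0 = τ}) ∧
    (∀ i, supCkENorm {x : E4 | x 0 = τ ∧
        (∀ j, r₀ j < Kerr.radius (a j) (poincareInv (mo j).1 (mo j).2 x)) ∧
        Kerr.radius (a i) (poincareInv (mo i).1 (mo i).2 x) ≤ R i} k
      (𝒟.toSpacetime.deviationExtend ⟨U, boostedKerrBilin (mo i).1 (mo i).2 (M i) (a i),
        fun x ↦ x 0, fun x ↦ Kerr.radius (a i) (poincareInv (mo i).1 (mo i).2 x)⟩ Φ) ≤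
      ENNReal.ofReal ε) ∧
    supCkENorm {x : E4 | x 0 = τ ∧
        (∀ j, r₀ j < Kerr.radius (a j) (poincareInv (mo j).1 (mo j).2 x)) ∧
        ∀ j, R j - 1 ≤ Kerr.radius (a j) (poincareInv (mo j).1 (mo j).2 x)} k
      (𝒟.toSpacetime.deviationExtend (Minkowski.backgroundOn U) Φ) ≤ ENNReal.ofReal ε ∧
    (∀ x : ↥U, x.1 0 = τ →
      (∀ j, R j - 1 ≤ Kerr.radius (a j) (poincareInv (mo j).1 (mo j).2 x.1)) →
      𝒟.timeOrientation.IsFutureDirected (mfderiv 𝓘(ℝ, E4) (𝓡 4) Φ x (E4.basisVector 0)))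

/-- **`SlabClauses` is the crux's block verbatim**: `KillingSpinorEndgame` unfolds, by `Iff.rfl`, to
its statement with clause (i) written `∀ ε > 0, ∀ τ₁, ∃ τ, τ₁ ≤ τ ∧ ∃ R U Φ, SlabClauses …`.
(Bookkeeping; the crux text is Theses/KerrnessPropagates.lean.) [folklore] -/
theorem killingSpinorEndgame_iff :
    KillingSpinorEndgame ↔
    ∃ k : ℕ, ∀ (X : Type) [TopologicalSpace X] [ChartedSpace E3 X] [IsManifold (𝓡 3) ∞ X]
      [T2Space X] [SecondCountableTopology X] [ConnectedSpace X] (D : InitialDataSet (𝓡 3) X),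
      D ∈ admissibleVacuumData X → ∀ 𝒟 : VacuumCauchyDevelopment D, 𝒟.IsMaximal →
      Summit.FinalStateConjecture.HasCompleteNullInfinity 𝒟.toCauchyDevelopment →
      (∃ (N : ℕ) (M a r₀ : Fin N → ℝ) (mo : Fin N → ↥lorentzGroup × E4),
        (∀ i, Kerr.IsSubextremal (M i) (a i) ∧
          r₀ i ∈ Ioo (Kerr.rMinus (M i) (a i)) (Kerr.rPlus (M i) (a i))) ∧
        ∀ ε : ℝ, 0 < ε → ∀ τ₁ : ℝ, ∃ τ : ℝ, τ₁ ≤ τ ∧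
          ∃ (R : Fin N → ℝ) (U : Opens E4) (Φ : U → 𝒟.carrier),
            SlabClauses 𝒟 k N M a r₀ mo ε τ R U Φ) →
      (∀ (O : Set 𝒟.carrier) (d : FinalStateDecomposition 𝒟.toSpacetime O 2),
        (∀ i, Kerr.IsSubextremal (d.mass i) (d.spin i)) →
        O = Summit.FinalStateConjecture.exteriorOf 𝒟.toCauchyDevelopment d.charted →
        Summit.FinalStateConjecture.HasExhaustiveCharts d →
        Summit.FinalStateConjecture.IsFutureOriented d →
        Summit.FinalStateConjecture.RaysStayInClosure 𝒟.toCauchyDevelopment O) →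
      ∃ (O : Set 𝒟.carrier) (d : FinalStateDecomposition 𝒟.toSpacetime O 2),
        (∀ i, Kerr.IsSubextremal (d.mass i) (d.spin i)) ∧
        O = Summit.FinalStateConjecture.exteriorOf 𝒟.toCauchyDevelopment d.charted ∧
        Summit.FinalStateConjecture.RaysStayInClosure 𝒟.toCauchyDevelopment O ∧
        Summit.FinalStateConjecture.HasExhaustiveCharts d ∧
        Summit.FinalStateConjecture.IsFutureOriented d :=
  Iff.rfl

/-- The **lab translation by `u`** from the translated domain `{x | x + u ∈ U}` onto `U`, as a map of
the open submanifolds (`ModelBackground.translate` for the Minkowski backgrounds on the two domains).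
O'Neill 1983, Ch. 9, p. 236. [cite: ONeill1983, Ch. 9 p. 236] -/
def shiftMap (U : Opens E4) (u : E4) : ↥(translatedOpens U u) → ↥U :=
  (Minkowski.backgroundOn (translatedOpens U u)).translate (Minkowski.backgroundOn U) u
    (fun _ hx ↦ hx)

/-- The translation in coordinates. [folklore] -/
@[simp] theorem shiftMap_coe (U : Opens E4) (u : E4) (x : ↥(translatedOpens U u)) :
    ((shiftMap U u x : ↥U) : E4) = (x : E4) + u := rfl

/-- Domain correspondence (onto): `y ∈ U ⇒ y − u ∈ {x | x + u ∈ U}`. [folklore] -/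
theorem sub_mem_translatedOpens {U : Opens E4} {u y : E4} (hy : y ∈ (U : Set E4)) :
    y - u ∈ (translatedOpens U u : Set E4) := by
  change y - u + u ∈ (U : Set E4)
  rwa [sub_add_cancel]

/-- The translation is surjective. [folklore] -/
theorem surjective_shiftMap (U : Opens E4) (u : E4) : Surjective (shiftMap U u) :=
  fun y ↦ ⟨⟨(y : E4) - u, sub_mem_translatedOpens y.2⟩, Subtype.ext (sub_add_cancel _ _)⟩

/-- The translation is smooth. [folklore] -/
theorem contMDiff_shiftMap (U : Opens E4) (u : E4) :
    ContMDiff 𝓘(ℝ, E4) 𝓘(ℝ, E4) ∞ (shiftMap U u) :=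
  (Minkowski.backgroundOn (translatedOpens U u)).contMDiff_translate (Minkowski.backgroundOn U) u _

/-- The translation is an open embedding (a homeomorphism of the two domains). [folklore] -/
theorem isOpenEmbedding_shiftMap (U : Opens E4) (u : E4) : Topology.IsOpenEmbedding (shiftMap U u) :=
  (Minkowski.backgroundOn (translatedOpens U u)).isOpenEmbedding_translate (Minkowski.backgroundOn U)
    u _ (fun _ hy ↦ sub_mem_translatedOpens hy)

/-- **The slab clauses are transported by any comoving lab translation.** If `Λⱼ⁻¹ u` is a multiple
of `∂₀` for every hole `j`, and `(R, U, Φ)` satisfies the slab clauses at `(ε, τ)`, then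
`(R, {x | x + u ∈ U}, Φ ∘ (· + u))` satisfies them at `(ε, τ − u⁰)`: the translation is a smooth
homeomorphism of the two domains with identity differential, the punctured hyperplanes, near discs and
far zones correspond (the rest-frame radii are `u`-invariant), the leaf image and the range are
unchanged, the deviations from the (`u`-invariant) references are the translates of the old ones so the
`Cᵏ` sup norms agree, and `d(Φ ∘ T)(∂₀) = dΦ(∂₀)` at corresponding points. DHRT arXiv:2104.08222, §1;
O'Neill 1983, Ch. 9, p. 236. [cite: arXiv210408222, §1] -/
theorem slabClauses_translate (𝒟 : VacuumCauchyDevelopment D) {k N : ℕ} {M a r₀ : Fin N → ℝ}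
    {mo : Fin N → ↥lorentzGroup × E4} {u : E4}
    (hu : ∀ j, ∃ t : ℝ, ((mo j).1 : E4 ≃L[ℝ] E4).symm u = t • E4.basisVector 0)
    {ε τ : ℝ} {R : Fin N → ℝ} {U : Opens E4} {Φ : U → 𝒟.carrier}
    (h : SlabClauses 𝒟 k N M a r₀ mo ε τ R U Φ) :
    SlabClauses 𝒟 k N M a r₀ mo ε (τ - u 0) R (translatedOpens U u) (Φ ∘ shiftMap U u) := by
  obtain ⟨hR, hsm, hemb, hU, hJ, hachr, hnear, hfar, hfd⟩ := h
  -- the translation calculus between the two domains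
  have hmem : ∀ x : E4, x ∈ ((Minkowski.backgroundOn (translatedOpens U u)).domain : Set E4) →
      x + u ∈ ((Minkowski.backgroundOn U).domain : Set E4) := fun _ hx ↦ hx
  have hmem' : ∀ y : E4, y ∈ ((Minkowski.backgroundOn U).domain : Set E4) →
      y - u ∈ ((Minkowski.backgroundOn (translatedOpens U u)).domain : Set E4) :=
    fun _ hy ↦ sub_mem_translatedOpens hy
  have hsm' : ContMDiff 𝓘(ℝ, E4) (𝓡 4) ∞ (Φ ∘ shiftMap U u) := hsm.comp (contMDiff_shiftMap U u)
  -- coordinates and rest-frame radii under the translation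
  have h0 : ∀ x : E4, (x + u) 0 = x 0 + u 0 := fun x ↦ by simp
  have h0' : ∀ y : E4, (y - u) 0 = y 0 - u 0 := fun y ↦ by simp
  have hr : ∀ (j : Fin N) (x : E4), Kerr.radius (a j) (poincareInv (mo j).1 (mo j).2 (x + u)) =
      Kerr.radius (a j) (poincareInv (mo j).1 (mo j).2 x) := by
    intro j x
    obtain ⟨t, ht⟩ := hu j
    exact radius_poincareInv_add_of_symm_eq (mo j).1 (mo j).2 (a j) ht x
  have hr' : ∀ (j : Fin N) (y : E4), Kerr.radius (a j) (poincareInv (mo j).1 (mo j).2 (y - u)) =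
      Kerr.radius (a j) (poincareInv (mo j).1 (mo j).2 y) := by
    intro j y
    have := hr j (y - u)
    rw [sub_add_cancel] at this
    exact this.symm
  -- translating the three kinds of certified sets at `τ − u⁰` gives those at `τ`
  have hset : ∀ Q : E4 → Prop, (∀ x, Q (x + u) ↔ Q x) →
      (fun y : E4 ↦ y + u) '' {x : E4 | x 0 = τ - u 0 ∧
        (∀ j, r₀ j < Kerr.radius (a j) (poincareInv (mo j).1 (mo j).2 x)) ∧ Q x} =
      {x : E4 | x 0 = τ ∧ (∀ j, r₀ j < Kerr.radius (a j) (poincareInv (mo j).1 (mo j).2 x)) ∧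
        Q x} := by
    intro Q hQ
    ext y
    simp only [mem_image, mem_setOf_eq]
    constructor
    · rintro ⟨x, ⟨hx0, hxr, hxQ⟩, rfl⟩
      exact ⟨by rw [h0, hx0]; ring, fun j ↦ by rw [hr]; exact hxr j, (hQ x).2 hxQ⟩
    · rintro ⟨hy0, hyr, hyQ⟩
      refine ⟨y - u, ⟨by rw [h0', hy0], fun j ↦ by rw [hr']; exact hyr j, ?_⟩, sub_add_cancel y u⟩
      have := (hQ (y - u)).1
      rw [sub_add_cancel] at this
      exact this hyQ
  refine ⟨hR, hsm', hemb.comp (isOpenEmbedding_shiftMap U u), ?_, ?_, ?_, ?_, ?_, ?_⟩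
  · -- the punctured hyperplane at `τ − u⁰` lies in the translated domain
    rintro x ⟨hx0, hxr⟩
    change x + u ∈ (U : Set E4)
    exact hU ⟨by rw [h0, hx0]; ring, fun j ↦ by rw [hr]; exact hxr j⟩
  · -- the range is unchanged
    exact (range_comp_subset_range (shiftMap U u) Φ).trans hJ
  · -- the leaf image is unchanged
    have himg : (Φ ∘ shiftMap U u) '' {x : ↥(translatedOpens U u) | (x : E4) 0 = τ - u 0} =
        Φ '' {x : ↥U | (x : E4) 0 = τ} := by
      rw [image_comp]
      congr 1
      ext y
      simp only [mem_image, mem_setOf_eq]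
      constructor
      · rintro ⟨x, hx, rfl⟩
        rw [shiftMap_coe, h0, hx]
        ring
      · intro hy
        refine ⟨⟨(y : E4) - u, sub_mem_translatedOpens y.2⟩, ?_, Subtype.ext (sub_add_cancel _ _)⟩
        change ((y : E4) - u) 0 = τ - u 0
        rw [h0', hy]
    rw [himg]
    exact hachr
  · -- near discs: the deviation of the translated chart is the translate of the deviation
    intro i
    obtain ⟨t, ht⟩ := hu i
    let B : ModelBackground := ⟨U, boostedKerrBilin (mo i).1 (mo i).2 (M i) (a i), fun x ↦ x 0,
      fun x ↦ Kerr.radius (a i) (poincareInv (mo i).1 (mo i).2 x)⟩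
    let B' : ModelBackground := ⟨translatedOpens U u, boostedKerrBilin (mo i).1 (mo i).2 (M i) (a i),
      fun x ↦ x 0, fun x ↦ Kerr.radius (a i) (poincareInv (mo i).1 (mo i).2 x)⟩
    have hbil : ∀ x : E4, x ∈ (B'.domain : Set E4) → B'.bilin x = B.bilin (x + u) :=
      fun x _ ↦ (boostedKerrBilin_add_of_symm_eq (mo i).1 (mo i).2 (M i) (a i) ht x).symm
    have hdev : 𝒟.toSpacetime.deviationExtend B' (Φ ∘ shiftMap U u) =
        fun y ↦ 𝒟.toSpacetime.deviationExtend B Φ (y + u) :=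
      𝒟.toSpacetime.deviationExtend_comp_translate B' B u hmem Φ hbil hmem' hsm
    change supCkENorm _ k (𝒟.toSpacetime.deviationExtend B' (Φ ∘ shiftMap U u)) ≤ ENNReal.ofReal ε
    rw [hdev, supCkENorm_comp_add_right,
      hset (fun x ↦ Kerr.radius (a i) (poincareInv (mo i).1 (mo i).2 x) ≤ R i)
        (fun x ↦ by rw [hr])]
    exact hnear i
  · -- far zone: `η` is constant
    have hbil : ∀ x : E4, x ∈ ((Minkowski.backgroundOn (translatedOpens U u)).domain : Set E4) →
        (Minkowski.backgroundOn (translatedOpens U u)).bilin x =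
          (Minkowski.backgroundOn U).bilin (x + u) :=
      fun _ _ ↦ rfl
    have hdev : 𝒟.toSpacetime.deviationExtend (Minkowski.backgroundOn (translatedOpens U u))
        (Φ ∘ shiftMap U u) =
        fun y ↦ 𝒟.toSpacetime.deviationExtend (Minkowski.backgroundOn U) Φ (y + u) :=
      𝒟.toSpacetime.deviationExtend_comp_translate _ _ u hmem Φ hbil hmem' hsm
    change supCkENorm _ k (𝒟.toSpacetime.deviationExtend
      (Minkowski.backgroundOn (translatedOpens U u)) (Φ ∘ shiftMap U u)) ≤ ENNReal.ofReal ε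
    rw [hdev, supCkENorm_comp_add_right,
      hset (fun x ↦ ∀ j, R j - 1 ≤ Kerr.radius (a j) (poincareInv (mo j).1 (mo j).2 x))
        (fun x ↦ by simp only [hr])]
    exact hfar
  · -- the push-forward of `∂₀` at `x` is that of `Φ` at `x + u`
    intro x hx0 hxR
    rw [show mfderiv 𝓘(ℝ, E4) (𝓡 4) (Φ ∘ shiftMap U u) x (E4.basisVector 0) =
        mfderiv 𝓘(ℝ, E4) (𝓡 4) Φ (shiftMap U u x) (E4.basisVector 0) from
      𝒟.toSpacetime.mfderiv_comp_translate_apply _ _ u hmem Φ hsm x _]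
    refine hfd (shiftMap U u x) ?_ fun j ↦ ?_
    · rw [shiftMap_coe, h0, hx0]
      ring
    · rw [shiftMap_coe, hr]
      exact hxR j

/-- **One slab gives slabs beyond every lab time** (comoving configurations). If some `w` with
`w⁰ ≠ 0` is comoving (`Λⱼ⁻¹ w ∈ ℝ ∂₀` for all `j`), then a single witness `(τ, R, U, Φ)` of the slab
clauses at accuracy `ε` yields, for every `τ₁`, a witness at a lab time `≥ τ₁` (indeed at `τ₁` itself:
translate by `u = ((τ − τ₁)/w⁰) w`). [folklore] -/
theorem forall_exists_ge_of_exists (𝒟 : VacuumCauchyDevelopment D) {k N : ℕ} {M a r₀ : Fin N → ℝ}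
    {mo : Fin N → ↥lorentzGroup × E4}
    (hw : ∃ w : E4, w 0 ≠ 0 ∧ ∀ j, ∃ t : ℝ, ((mo j).1 : E4 ≃L[ℝ] E4).symm w = t • E4.basisVector 0)
    {ε : ℝ} (h : ∃ (τ : ℝ) (R : Fin N → ℝ) (U : Opens E4) (Φ : U → 𝒟.carrier),
      SlabClauses 𝒟 k N M a r₀ mo ε τ R U Φ) :
    ∀ τ₁ : ℝ, ∃ τ : ℝ, τ₁ ≤ τ ∧ ∃ (R : Fin N → ℝ) (U : Opens E4) (Φ : U → 𝒟.carrier),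
      SlabClauses 𝒟 k N M a r₀ mo ε τ R U Φ := by
  intro τ₁
  obtain ⟨w, hw0, hw⟩ := hw
  obtain ⟨τ, R, U, Φ, h⟩ := h
  have hu : ∀ j, ∃ t : ℝ, ((mo j).1 : E4 ≃L[ℝ] E4).symm (((τ - τ₁) / w 0) • w) =
      t • E4.basisVector 0 := by
    intro j
    obtain ⟨t, ht⟩ := hw j
    exact ⟨(τ - τ₁) / w 0 * t, by rw [map_smul, ht, smul_smul]⟩
  have key := slabClauses_translate 𝒟 hu h
  have ht : τ - (((τ - τ₁) / w 0) • w) 0 = τ₁ := by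
    simp only [PiLp.smul_apply, smul_eq_mul]
    field_simp
    ring
  rw [ht] at key
  exact ⟨τ₁, le_rfl, R, _, _, key⟩

/-- **A comoving direction exists whenever all `Λⱼ ∂₀` coincide** (all holes share one asymptotic
4-velocity; vacuous content for `N = 0` is covered by `exists_comoving_zero`): take `w = Λⱼ₀ ∂₀`, whose
time component is non-zero by `NecksCertify.Negative.lorentz_basisVector_zero_apply_zero_ne_zero`
(Theorems/NecksCertify/Negative, reused). [folklore] -/
theorem exists_comoving_of_forall_eq {N : ℕ} (mo : Fin N → ↥lorentzGroup × E4) (j₀ : Fin N)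
    (hmo : ∀ j, ((mo j).1 : E4 ≃L[ℝ] E4) (E4.basisVector 0) =
      ((mo j₀).1 : E4 ≃L[ℝ] E4) (E4.basisVector 0)) :
    ∃ w : E4, w 0 ≠ 0 ∧ ∀ j, ∃ t : ℝ, ((mo j).1 : E4 ≃L[ℝ] E4).symm w = t • E4.basisVector 0 :=
  ⟨((mo j₀).1 : E4 ≃L[ℝ] E4) (E4.basisVector 0),
    NecksCertify.Negative.lorentz_basisVector_zero_apply_zero_ne_zero _,
    fun j ↦ ⟨1, by rw [← hmo j, ContinuousLinearEquiv.symm_apply_apply, one_smul]⟩⟩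

/-- For `N = 0` every vector is comoving; `∂₀` itself has `(∂₀)⁰ = 1 ≠ 0`. [folklore] -/
theorem exists_comoving_zero (mo : Fin 0 → ↥lorentzGroup × E4) :
    ∃ w : E4, w 0 ≠ 0 ∧ ∀ j, ∃ t : ℝ, ((mo j).1 : E4 ≃L[ℝ] E4).symm w = t • E4.basisVector 0 :=
  ⟨E4.basisVector 0, by simp, fun j ↦ j.elim0⟩

/-- **For comoving configurations the recurrence clause (i) at accuracy `ε` is equivalent to the
existence of ONE `ε`-good slab** (at any lab time): the quantifier `∀ τ₁, ∃ τ ≥ τ₁` is idle.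
[folklore] -/
theorem recurrence_iff_exists_slab_of_forall_eq (𝒟 : VacuumCauchyDevelopment D) {k N : ℕ}
    {M a r₀ : Fin N → ℝ} {mo : Fin N → ↥lorentzGroup × E4} (j₀ : Fin N)
    (hmo : ∀ j, ((mo j).1 : E4 ≃L[ℝ] E4) (E4.basisVector 0) =
      ((mo j₀).1 : E4 ≃L[ℝ] E4) (E4.basisVector 0)) (ε : ℝ) :
    (∀ τ₁ : ℝ, ∃ τ : ℝ, τ₁ ≤ τ ∧ ∃ (R : Fin N → ℝ) (U : Opens E4) (Φ : U → 𝒟.carrier),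
      SlabClauses 𝒟 k N M a r₀ mo ε τ R U Φ) ↔
    ∃ (τ : ℝ) (R : Fin N → ℝ) (U : Opens E4) (Φ : U → 𝒟.carrier),
      SlabClauses 𝒟 k N M a r₀ mo ε τ R U Φ := by
  constructor
  · intro h
    obtain ⟨τ, -, R, U, Φ, hs⟩ := h 0
    exact ⟨τ, R, U, Φ, hs⟩
  · exact forall_exists_ge_of_exists 𝒟 (exists_comoving_of_forall_eq mo j₀ hmo)

/-- **`N = 1`: for EVERY one-hole configuration the recurrence clause is equivalent to the existence of
one slab** — the crux's ENDGAME receives no lateness for a single boosted Kerr black hole (nor, by time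
reversal `Λ ∈ O(1,3) ∖ O⁺(1,3)`, for a white-hole configuration). [folklore] -/
theorem recurrence_one_iff (𝒟 : VacuumCauchyDevelopment D) {k : ℕ} {M a r₀ : Fin 1 → ℝ}
    (mo : Fin 1 → ↥lorentzGroup × E4) (ε : ℝ) :
    (∀ τ₁ : ℝ, ∃ τ : ℝ, τ₁ ≤ τ ∧ ∃ (R : Fin 1 → ℝ) (U : Opens E4) (Φ : U → 𝒟.carrier),
      SlabClauses 𝒟 k 1 M a r₀ mo ε τ R U Φ) ↔
    ∃ (τ : ℝ) (R : Fin 1 → ℝ) (U : Opens E4) (Φ : U → 𝒟.carrier),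
      SlabClauses 𝒟 k 1 M a r₀ mo ε τ R U Φ :=
  recurrence_iff_exists_slab_of_forall_eq 𝒟 0 (fun j ↦ by rw [Subsingleton.elim j 0]) ε

/-- **`N = 0`: the dispersal recurrence clause is equivalent to the existence of one `ε`-flat achronal
slab.** [folklore] -/
theorem recurrence_zero_iff (𝒟 : VacuumCauchyDevelopment D) {k : ℕ} {M a r₀ : Fin 0 → ℝ}
    (mo : Fin 0 → ↥lorentzGroup × E4) (ε : ℝ) :
    (∀ τ₁ : ℝ, ∃ τ : ℝ, τ₁ ≤ τ ∧ ∃ (R : Fin 0 → ℝ) (U : Opens E4) (Φ : U → 𝒟.carrier),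
      SlabClauses 𝒟 k 0 M a r₀ mo ε τ R U Φ) ↔
    ∃ (τ : ℝ) (R : Fin 0 → ℝ) (U : Opens E4) (Φ : U → 𝒟.carrier),
      SlabClauses 𝒟 k 0 M a r₀ mo ε τ R U Φ := by
  constructor
  · intro h
    obtain ⟨τ, -, R, U, Φ, hs⟩ := h 0
    exact ⟨τ, R, U, Φ, hs⟩
  · exact forall_exists_ge_of_exists 𝒟 (exists_comoving_zero mo)

/-- **Registered sub-goal `recurrence_lateness_idle` of crux stmt-FinalStateConjecture-17645** (closed
form of `recurrence_one_iff`): for every development and EVERY one-hole configuration, clause (i) of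
`KillingSpinorEndgame` at accuracy `ε` — "beyond every lab time an `ε`-good slab" — is equivalent to the
existence of one `ε`-good slab. [folklore] -/
theorem recurrence_lateness_idle : ∀ (X : Type) [TopologicalSpace X] [ChartedSpace E3 X]
    [IsManifold (𝓡 3) ∞ X] [ConnectedSpace X] (D : InitialDataSet (𝓡 3) X)
    (𝒟 : VacuumCauchyDevelopment D) (k : ℕ) (M a r₀ : Fin 1 → ℝ) (mo : Fin 1 → ↥lorentzGroup × E4)
    (ε : ℝ), (∀ τ₁ : ℝ, ∃ τ : ℝ, τ₁ ≤ τ ∧ ∃ (R : Fin 1 → ℝ) (U : Opens E4) (Φ : U → 𝒟.carrier),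
      SlabClauses 𝒟 k 1 M a r₀ mo ε τ R U Φ) ↔
    ∃ (τ : ℝ) (R : Fin 1 → ℝ) (U : Opens E4) (Φ : U → 𝒟.carrier),
      SlabClauses 𝒟 k 1 M a r₀ mo ε τ R U Φ :=
  fun _ _ _ _ _ _ 𝒟 _ _ _ _ mo ε ↦ recurrence_one_iff 𝒟 mo ε

end Summit.FinalStateConjecture.FinalStateConjecture.Theorems.KerrnessPropagates

end
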